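import Summits.QuantumFields.YangMills.Theorems.BalabanUVNodesPortS1JacCover

/-!
# NODE O port PT-A — ROW (e) OF `stub_LZjac`: (LOC) — THE INTEGER FORMULA `Ψ_jac` IS WINDOW-LOCAL at cube side `L^{k+1}·Mc` (the `IntLocalFormula.isLocal` field), via the TOWER LOCALITY
# of the integer `k`-fold (0.4) iterate and of the integer Jacobian functional `J_ℤ(ĉ, 𝐔)` (it reads the two `(k+1)`-blocks under `ĉ₋, ĉ₊` only)

Cell `ym-nodeO-ideate`, porter seat `ymgap-nodeO-port-PTA-1` (gen 6); `--supports stmt-QuantumFields-27930` (helper); objects ✓ `…PortS1JacPiecesDefs`, two-block locality ✓ `…PortS1JacCover` §3.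
[I] = [Balaban1987RG1].  Print: (1.7) p.261 «the term corresponding to a domain X depends on U_j restricted to X».
* §1 `blockMap_of_mem_winSitesZ`, `blockMap_pow_blockMap`, ★ `iterMhZ_congr_of_tower` (induction on levels over `avgMhZ_congr_of_eqOn_winBondsZ`), ★ `jacZ_congr`.
* §2 `mem_cubeExt_blockMap`, `blockMap_mem_cubesetZ_of_mem`, ★★ `isLocal_ΨjacRaw : (ΨjacRaw F Mc k).IsLocal (F.L ^ (k + 1) * Mc)` (`0 < Mc`).
The (GI) field and the torus rows are the next files.

HONEST FRAMING.  Lattice bookkeeping; NOTHING of Bałaban's estimates asserted, ported or discharged; `stub_LZjac` OPEN; 27930 OPEN · no claim; K0⁷∕K-Ax OPEN; NODE O 0∕1; COUNT 8∕28 · K 1∕4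
UNMOVED; finite `𝕋⁴_{L^K}` at fixed ε — NOT continuum ∕ OS ∕ Clay; **the Yang–Mills mass gap is NOT proved by any of this.**  No `sorry`, no `def`, no `instance`, no `notation`; standard axioms.
-/

noncomputable section

open scoped BigOperators Matrix.Norms.L2Operator Topology

namespace Summit.QuantumFields.YangMills.Theorems.BalabanUVNodesPortS1

open Summit.QuantumFields.YangMills.Theorems.K0RecordFormatNames
open Literature.MathematicalPhysics.QuantumFieldTheory.Balaban1983to89
open Literature.MathematicalPhysics.QuantumFieldTheory.Balaban1983to89.Node00
open Literature.MathematicalPhysics.QuantumFieldTheory.Balaban1983to89.T4Continuum (T4Family Letter LStep)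
open Literature.MathematicalPhysics.QuantumFieldTheory.Balaban1983to89.B7Prop1Explicit (e e_apply)
open Literature.MathematicalPhysics.QuantumFieldTheory.Balaban1983to89.BlockAveragingZd (IdxZ offZ)
open Literature.MathematicalPhysics.QuantumFieldTheory.Balaban1983to89.B14.Eq213MaximalDomains (cubeExt)
open Literature.MathematicalPhysics.QuantumLattice (blockMap blockSites mem_blockSites_iff)
open _root_.Matrix

/-! ## §1  Window sites and blocks; the tower locality of the integer iterate -/

section Tower

variable {d : ℕ}

/-- A window site lies in one of the two blocks: `⌊z∕L⌋ ∈ {ĉ₋, ĉ₊}`. [cite: Balaban1987RG1, (0.4) p.253 (bookkeeping)] -/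
theorem blockMap_of_mem_winSitesZ {L : ℕ} [NeZero L] {ĉ : (Fin d → ℤ) × Fin d} {z : Fin d → ℤ} (hz : z ∈ winSitesZ L ĉ) :
    blockMap L z = ĉ.1 ∨ blockMap L z = ĉ.1 + e ĉ.2 := by
  unfold winSitesZ at hz
  rw [Finset.mem_union, mem_blockSites_iff, mem_blockSites_iff] at hz
  exact hz

/-- `⌊⌊z∕L⌋ ∕ L^n⌋ = ⌊z ∕ L^{n+1}⌋`. [cite: Balaban1984PropagatorsI, (1.16) p.20 (blocks of blocks)] -/
theorem blockMap_pow_blockMap (L n : ℕ) (z : Fin d → ℤ) : blockMap (L ^ n) (blockMap L z) = blockMap (L ^ (n + 1)) z := by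
  funext i
  simp only [blockMap]
  push_cast
  rw [Int.ediv_ediv_of_nonneg (by positivity : (0 : ℤ) ≤ (L : ℤ)), pow_succ']

/-- ★ **TOWER LOCALITY OF THE INTEGER ITERATE**: if two fine configurations agree on the bonds whose endpoints have their `L^n`-block in `T`, then their `j`-fold averages (`j ≤ n`) agree on the
level-`j` bonds whose endpoints have their `L^{n−j}`-block in `T` (induction on the two-block locality of ✓ `avgMhZ_congr_of_eqOn_winBondsZ`). [cite: Balaban1987RG1, (0.4) p.253, (0.21) p.256, (1.7) p.261] -/
theorem iterMhZ_congr_of_tower {L : ℕ} (hL : 2 * ((L - 1) / 2) + 1 = L) (T : Set (Fin d → ℤ)) (n : ℕ) {U U' : (Fin d → ℤ) × Fin d → MatA 2}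
    (hUU' : ∀ b : (Fin d → ℤ) × Fin d, blockMap (L ^ n) b.1 ∈ T → blockMap (L ^ n) (b.1 + e b.2) ∈ T → U b = U' b) :
    ∀ j : ℕ, j ≤ n → ∀ b : (Fin d → ℤ) × Fin d, blockMap (L ^ (n - j)) b.1 ∈ T → blockMap (L ^ (n - j)) (b.1 + e b.2) ∈ T →
      iterMhZ L j U b = iterMhZ L j U' b
  | 0, _, b, h1, h2 => by
    rw [Nat.sub_zero] at h1 h2
    exact hUU' b h1 h2
  | j + 1, hj, ĉ, h1, h2 => by
    haveI : NeZero L := ⟨by omega⟩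
    show avgMhZ L (iterMhZ L j U) ĉ = avgMhZ L (iterMhZ L j U') ĉ
    refine avgMhZ_congr_of_eqOn_winBondsZ hL ĉ fun b hb => ?_
    obtain ⟨hb1, hb2⟩ := mem_winBondsZ_iff.1 hb
    have hnj : n - j = n - (j + 1) + 1 := by omega
    have key : ∀ z ∈ winSitesZ L ĉ, blockMap (L ^ (n - j)) z ∈ T := by
      intro z hz
      rw [hnj, ← blockMap_pow_blockMap]
      rcases blockMap_of_mem_winSitesZ hz with h | h <;> rw [h]
      · exact h1
      · exact h2
    exact iterMhZ_congr_of_tower hL T n hUU' j (Nat.le_of_succ_le hj) b (key _ hb1) (key _ hb2)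

/-- ★ **LOCALITY OF THE INTEGER JACOBIAN FUNCTIONAL**: `J_ℤ(ĉ, 𝐔)` reads the fine configuration `𝐔` only on the bonds whose endpoints lie in the two `(k+1)`-blocks under `ĉ₋, ĉ₊`
(`⌊z ∕ L^{k+1}⌋ ∈ {ĉ₋, ĉ₊}`). [cite: Balaban1987RG1, (1.7) p.261, p.267–268] -/
theorem jacZ_congr {L : ℕ} (hL : 2 * ((L - 1) / 2) + 1 = L) (k : ℕ) (ĉ : (Fin d → ℤ) × Fin d) {U U' : (Fin d → ℤ) × Fin d → MatA 2}
    (hUU' : ∀ b : (Fin d → ℤ) × Fin d, blockMap (L ^ (k + 1)) b.1 ∈ ({ĉ.1, ĉ.1 + e ĉ.2} : Set (Fin d → ℤ)) →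
      blockMap (L ^ (k + 1)) (b.1 + e b.2) ∈ ({ĉ.1, ĉ.1 + e ĉ.2} : Set (Fin d → ℤ)) → U b = U' b) :
    jacZ L k ĉ U = jacZ L k ĉ U' := by
  haveI : NeZero L := ⟨by omega⟩
  unfold jacZ
  refine jacFactorZ_congr_of_eqOn_winBondsZ hL ĉ fun b hb => ?_
  obtain ⟨hb1, hb2⟩ := mem_winBondsZ_iff.1 hb
  have key : ∀ z ∈ winSitesZ L ĉ, blockMap (L ^ (k + 1 - k)) z ∈ ({ĉ.1, ĉ.1 + e ĉ.2} : Set (Fin d → ℤ)) := by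
    intro z hz
    rw [show k + 1 - k = 1 by omega, pow_one]
    rcases blockMap_of_mem_winSitesZ hz with h | h <;> rw [h]
    · exact Or.inl rfl
    · exact Or.inr rfl
  exact iterMhZ_congr_of_tower hL _ (k + 1) hUU' k (Nat.le_succ k) b (key _ hb1) (key _ hb2)

end Tower

/-! ## §2  ★★ WINDOW-LOCALITY (LOC) of the integer formula `Ψ_jac` at cube side `s = L^{k+1} · Mc` -/

section Loc

variable {d : ℕ}

/-- A point lies in the `s`-cube of its `s`-block index (`B14.Eq213MaximalDomains.cubeExt`, collar `0`). [folklore] -/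
theorem mem_cubeExt_blockMap {s : ℕ} (hs : 0 < s) (z : Fin d → ℤ) : z ∈ cubeExt s (blockMap s z) 0 := by
  intro i
  have hs' : (0 : ℤ) < s := by exact_mod_cast hs
  have h1 := Int.emod_add_mul_ediv (z i) (s : ℤ)
  have h2 := Int.emod_nonneg (z i) hs'.ne'
  have h3 := Int.emod_lt_of_pos (z i) hs'
  simp only [blockMap, sub_zero, add_zero]
  constructor <;> linarith

/-- The cube set of an integer coarse bond collects the `Mc`-blocks of the two ends. [cite: Balaban1987RG1, p.257 (bookkeeping)] -/
theorem blockMap_mem_cubesetZ_of_mem {Mc : ℕ} {ĉ : (Fin d → ℤ) × Fin d} {y : Fin d → ℤ} (hy : y ∈ ({ĉ.1, ĉ.1 + e ĉ.2} : Set (Fin d → ℤ))) :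
    blockMap Mc y ∈ cubesetZ Mc ĉ := by
  unfold cubesetZ
  rw [Finset.mem_insert, Finset.mem_singleton]
  rcases hy with h | h
  · exact Or.inl (by rw [h])
  · exact Or.inr (by rw [Set.mem_singleton_iff.1 h])

/-- ★★ **(LOC) WINDOW-LOCALITY OF `Ψ_jac`**: `ΨjacRaw F Mc k X̂ f` depends on `f` only at the integer bonds with both ends in the integer sites of `X̂` at cube side `L^{k+1}·Mc` — the
`IntLocalFormula.isLocal` field ([I] (1.7) «the term corresponding to a domain X depends on U_j restricted to X»).  Each summand `J_ℤ(ĉ, f.1)` reads the two `(k+1)`-blocks under `ĉ`,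
which lie in the cubes `cubesetZ Mc ĉ = X̂`. [cite: Balaban1987RG1, (1.7) p.261, p.267–268] -/
theorem isLocal_ΨjacRaw (F : T4Family) {Mc : ℕ} (hMc : 0 < Mc) (k : ℕ) : (ΨjacRaw F Mc k).IsLocal (F.L ^ (k + 1) * Mc) := by
  have hL : 2 * ((F.L - 1) / 2) + 1 = F.L := AveragingRT.two_mul_half_add_one (F.P 0)
  have hs : 0 < F.L ^ (k + 1) * Mc := Nat.mul_pos (pow_pos (F.P 0).L_pos _) hMc
  intro Xh f f' hff'
  show -∑ ĉ ∈ coarseBondsOf Mc Xh, (jacZ F.L k ĉ (fun b => (f b).1) - jacZ F.L k ĉ 1) =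
    -∑ ĉ ∈ coarseBondsOf Mc Xh, (jacZ F.L k ĉ (fun b => (f' b).1) - jacZ F.L k ĉ 1)
  refine congrArg Neg.neg (Finset.sum_congr rfl fun ĉ hĉ => ?_)
  have hcube : cubesetZ Mc ĉ = Xh := (Finset.mem_filter.1 hĉ).2
  refine congrArg (· - jacZ F.L k ĉ 1) (jacZ_congr hL k ĉ fun b hb1 hb2 => ?_)
  have hmem : ∀ z : Fin 4 → ℤ, blockMap (F.L ^ (k + 1)) z ∈ ({ĉ.1, ĉ.1 + e ĉ.2} : Set (Fin 4 → ℤ)) →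
      z ∈ ⋃ a ∈ Xh, cubeExt (F.L ^ (k + 1) * Mc) a 0 := by
    intro z hz
    refine Set.mem_iUnion₂.2 ⟨blockMap (F.L ^ (k + 1) * Mc) z, ?_, mem_cubeExt_blockMap hs z⟩
    rw [← hcube, show blockMap (F.L ^ (k + 1) * Mc) z = blockMap Mc (blockMap (F.L ^ (k + 1)) z) from ?_]
    · exact blockMap_mem_cubesetZ_of_mem hz
    · funext i
      simp only [blockMap]
      push_cast
      rw [Int.ediv_ediv_of_nonneg (by positivity : (0 : ℤ) ≤ (F.L : ℤ) ^ (k + 1))]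
  have h := hff' b (hmem _ hb1) (by rw [update_add_one_eq_add_e]; exact hmem _ hb2)
  exact congrArg Prod.fst h

end Loc

end Summit.QuantumFields.YangMills.Theorems.BalabanUVNodesPortS1

end
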